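import Literature.Claims.NS.Chio2026
import Summits.NavierStokesRegularity.NavierStokesRegularity.Theorems.SoloSalvageChio2026

/-!
# C55 `Chio2026` — kernel refutation of the «pointwise mechanical energy transport equation» (§3.1 p. 4)

D-0090 NS-CLAIMS sweep, row C55 (arXiv:2603.28308 v2, Chio Chon Kit, «Finite-Time Weak Singularities and
the Statistical Structure of Turbulence in 3D Incompressible Navier–Stokes Equations»). Refuter of record
ns-claims-refuter-6 (kernel author); skeleton of record `Literature/Claims/NS/Chio2026.lean` (p479182,
ns-claims-typist-10); true-content companion `SoloSalvageChio2026.lean` (p479936, ns-claims-salvage-p5 g2),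
whose `timeDerivWithin_mechE` / `critQ_eq` are used below; cross-check: typist-10's plane-Couette kill
candidate (claims/Chio2026/SoloRefuteChio2026-typist10-KILLCANDIDATE.lean, not filed).

**Locator.** §3.1 p. 4 (TeX l.103–114): «Taking the dot product of the NS momentum equation with the
velocity field u, and applying the incompressibility condition ∇·u = 0 … we derive the pointwise mechanical
energy transport equation ∂ₜE + u·∇E = −ν|∇u|²», `E = ½|u|² + p` — typed at the solution grain as
`Literature.Claims.NS.Chio2026.Step_0` (every strong solution with no-slip on an open `Ω`, every
`(t,x) ∈ [0,T) × Ω`) and at the grain of its printed derivation as `EnergyTransport_pt`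
(`step0_of_pt : EnergyTransport_pt → Step_0`). It is the common input of the printed proofs of Lemma 1
(p. 4), Lemma 2 (p. 5) and Lemma 3 (p. 6).

**What dotting the momentum equation with `u` really gives** (kernel: `energyTransport_true`, p479936):
`∂ₜ(½|u|²) + u·∇(½|u|² + p) = ν⟪u,Δu⟫ = νΔ(½|u|²) − ν|∇u|²`; the printed display therefore holds at a point
iff `∂ₜp + ν(⟪u,Δu⟫ + |∇u|²) = 0` there (`printedDisplay_iff_defect`).

**Witness (a no-slip, time-decaying exact solution — the Stokes mode of the plane channel).**
`Ω = {x : 0 < x₁ < π}` (open; its frontier is the two walls `x₁ = 0`, `x₁ = π`),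
`u(t,x) = e^{−νt} sin(x₁) e₀`, `p ≡ 0`, `u₀ = u(0)`: smooth, divergence free, `(u·∇)u = 0`,
`Δu = −u`, `∂ₜu = −νu`, so the momentum equation holds on all of `ℝ³`, and `u = 0` on both walls. At
`t = 0` and the mid-channel point `x* = (π/2)e₁ ∈ Ω`: `∂ₜE = ⟪u,∂ₜu⟫ = −ν`, `u·∇E = 0`, while
`|∇u(x*)|² = cos²(π/2) = 0`; the display reads `−ν = 0`. (The defect `∂ₜp + ν(⟪u,Δu⟫ + |∇u|²)` equals
`ν e^{−2νt} cos(2x₁)`: it depends on `x`, so no pressure gauge `p ↦ p + c(t)` repairs the display for this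
flow — `step0_fails_any_gauge`; by contrast plane Couette `u = x₁e₀` satisfies the display with the gauge
`p = −νt`.)

Main results: `step0_fails` (every `ν > 0`, every `T > 0`), `not_Step_0 : ¬ Step_0`,
`not_EnergyTransport_pt : ¬ EnergyTransport_pt` (via `step0_of_pt`), `step0_fails_any_gauge`.
Class (cell vocabulary): false lemma (countermodel). Standard axioms only.

WHAT THIS IS NOT: not a claim about NS regularity or blow-up; not a claim about any author beyond the typed
locator.
-/

set_option linter.dupNamespace false

open Set
open scoped ContDiff Laplacian InnerProductSpace RealInnerProductSpace

namespace Summit.NavierStokesRegularity.NavierStokesRegularity.Theorems.Chio2026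

open Literature.Analysis.FluidPDE Literature.Claims.NS.Chio2026

noncomputable section

/-! ### The witness -/

/-- The unit vector `e₀`. [folklore] -/
def e0 : E3 := EuclideanSpace.single 0 1

/-- The coordinate functional `x ↦ x₁`. [folklore] -/
def P1 : E3 →L[ℝ] ℝ := EuclideanSpace.proj (1 : Fin 3)

/-- The shear matrix `v ↦ v₁ e₀` (the velocity gradient direction of every `x₁`-dependent flow along `e₀`).
[folklore] -/
def shearL : E3 →L[ℝ] E3 := P1.smulRight e0

/-- The channel mode profile with amplitude `a`: `U_a(x) = a sin(x₁) e₀`. [folklore] -/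
def modeU (a : ℝ) (x : E3) : E3 := (a * Real.sin (x 1)) • e0

/-- The witness velocity `u(t,x) = e^{−νt} sin(x₁) e₀` (Stokes mode of the plane channel). [folklore] -/
def uCh (ν : ℝ) : ℝ → E3 → E3 := fun t x => modeU (Real.exp (-ν * t)) x

/-- The witness pressure `p ≡ 0`. [folklore] -/
def pCh : ℝ → E3 → ℝ := fun _ _ => 0

/-- The plane channel `Ω = {x : 0 < x₁ < π}`. [folklore] -/
def slab : Set E3 := (fun x : E3 => x 1) ⁻¹' Ioo 0 Real.pi

/-- The mid-channel point `x* = (π/2) e₁`. [folklore] -/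
def xMid : E3 := EuclideanSpace.single 1 (Real.pi / 2)

/-- The quarter-channel point `x♯ = (π/4) e₁`. [folklore] -/
def xQ : E3 := EuclideanSpace.single 1 (Real.pi / 4)

/-- A pressure gauge: the spatially constant pressure `p(t,x) = c(t)` (every pressure compatible with the
witness velocity is of this form, since `∇p = −∂ₜu − (u·∇)u + νΔu = 0`). [folklore] -/
def pG (c : ℝ → ℝ) : ℝ → E3 → ℝ := fun t _ => c t

/-! ### Elementary facts about the profile -/

/-- `P1 x = x₁`. [folklore] -/
@[simp] theorem P1_apply (x : E3) : P1 x = x 1 := rfl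

/-- `(e₀)₁ = 0`. [folklore] -/
@[simp] theorem e0_apply_one : e0 1 = 0 := by simp [e0]

/-- `‖e₀‖ = 1`. [folklore] -/
@[simp] theorem norm_e0 : ‖e0‖ = 1 := by simp [e0]

/-- `shearL v = v₁ e₀`. [folklore] -/
@[simp] theorem shearL_apply (v : E3) : shearL v = (v 1) • e0 := rfl

/-- `(x*)₁ = π/2`. [folklore] -/
@[simp] theorem xMid_apply_one : xMid 1 = Real.pi / 2 := by simp [xMid]

/-- `(x♯)₁ = π/4`. [folklore] -/
@[simp] theorem xQ_apply_one : xQ 1 = Real.pi / 4 := by simp [xQ]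

/-- `x♯` lies in the channel. [folklore] -/
theorem xQ_mem_slab : xQ ∈ slab := by
  simp only [slab, mem_preimage, xQ_apply_one, mem_Ioo]
  constructor <;> linarith [Real.pi_pos]

/-- `x*` lies in the channel. [folklore] -/
theorem xMid_mem_slab : xMid ∈ slab := by
  simp only [slab, mem_preimage, xMid_apply_one, mem_Ioo]
  constructor <;> linarith [Real.pi_pos]

/-- The channel is open. [folklore] -/
theorem isOpen_slab : IsOpen slab := isOpen_Ioo.preimage P1.continuous

/-- On the walls `x₁ ∈ {0, π}`. [folklore] -/
theorem apply_one_of_mem_frontier_slab {x : E3} (hx : x ∈ frontier slab) : x 1 = 0 ∨ x 1 = Real.pi := by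
  have h := P1.continuous.frontier_preimage_subset (Ioo 0 Real.pi) hx
  rw [frontier_Ioo Real.pi_pos] at h
  simpa using h

/-- The profile is smooth. [folklore] -/
theorem contDiff_modeU (a : ℝ) : ContDiff ℝ ∞ (modeU a) :=
  (contDiff_const.mul (Real.contDiff_sin.comp P1.contDiff)).smul contDiff_const

/-- `DU_a(x) = a cos(x₁) · shearL`. [folklore] -/
theorem hasFDerivAt_modeU (a : ℝ) (x : E3) :
    HasFDerivAt (modeU a) ((a * Real.cos (x 1)) • shearL) x := by
  have h2 : HasFDerivAt (fun z : E3 => Real.sin (P1 z)) (Real.cos (P1 x) • P1) x :=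
    (Real.hasDerivAt_sin (P1 x)).comp_hasFDerivAt x P1.hasFDerivAt
  have h3 : HasFDerivAt (fun z : E3 => (a * Real.sin (P1 z)) • e0)
      ((a • (Real.cos (P1 x) • P1)).smulRight e0) x := (h2.const_mul a).smul_const e0
  have hder : (a * Real.cos (x 1)) • shearL = (a • (Real.cos (P1 x) • P1)).smulRight e0 := by
    ext v i
    simp [smul_smul]
  rw [hder]
  exact h3

/-- `DU_a(x) = a cos(x₁) · shearL` as an `fderiv`. [folklore] -/
theorem fderiv_modeU (a : ℝ) (x : E3) : fderiv ℝ (modeU a) x = (a * Real.cos (x 1)) • shearL :=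
  (hasFDerivAt_modeU a x).fderiv

/-- The second derivative: `D(DU_a)(x) = (−a sin(x₁) P1) ⊗ shearL`. [folklore] -/
theorem hasFDerivAt_fderiv_modeU (a : ℝ) (x : E3) :
    HasFDerivAt (fderiv ℝ (modeU a)) ((a • (-Real.sin (P1 x) • P1)).smulRight shearL) x := by
  have hfun : fderiv ℝ (modeU a) = fun z : E3 => (a * Real.cos (P1 z)) • shearL := by
    funext z; rw [fderiv_modeU, P1_apply]
  have h2 : HasFDerivAt (fun z : E3 => Real.cos (P1 z)) (-Real.sin (P1 x) • P1) x :=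
    (Real.hasDerivAt_cos (P1 x)).comp_hasFDerivAt x P1.hasFDerivAt
  rw [hfun]
  exact (h2.const_mul a).smul_const shearL

/-- `ΔU_a = −U_a` (the profile is a Stokes eigenmode). [folklore] -/
theorem laplacian_modeU (a : ℝ) (x : E3) : Δ (modeU a) x = (-(a * Real.sin (x 1))) • e0 := by
  rw [InnerProductSpace.laplacian_eq_iteratedFDeriv_orthonormalBasis (modeU a)
    (EuclideanSpace.basisFun (Fin 3) ℝ)]
  simp only [iteratedFDeriv_two_apply]
  rw [(hasFDerivAt_fderiv_modeU a x).fderiv]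
  simp [Fin.sum_univ_three, e0, smul_smul]

/-- The profile is divergence free. [folklore] -/
theorem divergence_modeU (a : ℝ) (x : E3) : VectorCalculus.divergence (modeU a) x = 0 := by
  rw [divergence_eq_sum_inner_fderiv (EuclideanSpace.basisFun (Fin 3) ℝ), fderiv_modeU]
  simp [Fin.sum_univ_three, e0, EuclideanSpace.inner_single_left]

/-- `(U_a·∇)U_a = 0`. [folklore] -/
theorem convect_modeU (a : ℝ) (x : E3) : convect (modeU a) (modeU a) x = 0 := by
  simp [convect, fderiv_modeU, modeU]

/-- `∂ₜu = −νu` pointwise, as a derivative in `t`. [folklore] -/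
theorem hasDerivAt_uCh (ν t : ℝ) (x : E3) :
    HasDerivAt (fun s => uCh ν s x) (((-(ν * Real.exp (-ν * t))) * Real.sin (x 1)) • e0) t := by
  have h1 : HasDerivAt (fun s : ℝ => -ν * s) (-ν) t := by
    simpa using (hasDerivAt_id t).const_mul (-ν)
  have h2 : HasDerivAt (fun s : ℝ => Real.exp (-ν * s)) (Real.exp (-ν * t) * -ν) t :=
    (Real.hasDerivAt_exp _).comp t h1
  have h3 := (h2.mul_const (Real.sin (x 1))).smul_const e0
  have hfun : (fun s => uCh ν s x) = fun s => (Real.exp (-ν * s) * Real.sin (x 1)) • e0 := rfl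
  have hval : ((-(ν * Real.exp (-ν * t))) * Real.sin (x 1)) • e0 =
      (Real.exp (-ν * t) * -ν * Real.sin (x 1)) • e0 := by
    congr 1
    ring
  rw [hfun, hval]
  exact h3

/-- `∂ₜu` within `[0,T)`: `= −ν e^{−νt} sin(x₁) e₀`. [folklore] -/
theorem timeDerivWithin_uCh (ν : ℝ) {T t : ℝ} (ht : t ∈ Ico 0 T) (x : E3) :
    timeDerivWithin (Ico 0 T) (uCh ν) t x = ((-(ν * Real.exp (-ν * t))) * Real.sin (x 1)) • e0 :=
  (hasDerivAt_uCh ν t x).hasDerivWithinAt.derivWithin (uniqueDiffOn_Ico 0 T t ht)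

/-- `∂ₜp = 0` within any time set. [folklore] -/
theorem timeDerivWithin_pCh (S : Set ℝ) (t : ℝ) (x : E3) : timeDerivWithin S pCh t x = 0 := by
  simp [timeDerivWithin, pCh]

/-- `∇p = 0`. [folklore] -/
theorem gradient_pCh (t : ℝ) (x : E3) : gradient (pCh t) x = 0 := gradient_fun_const x 0

/-! ### The witness is a strong solution with no-slip on the channel -/

/-- For every `ν` and `T`, `(u, p) = (e^{−νt} sin(x₁) e₀, 0)` is a strong solution on the channel
`{0 < x₁ < π} × [0,T)` in the sense of `IsStrongSolutionOn` (no-slip on both walls). [folklore] -/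
theorem isStrongSolutionOn_uCh (ν T : ℝ) :
    IsStrongSolutionOn slab (Ico 0 T) ν (uCh ν 0) (uCh ν) pCh where
  smooth_u t _ := contDiff_modeU _
  smooth_p _ _ := contDiff_const
  timeDiff t _ x _ :=
    ⟨(hasDerivAt_uCh ν t x).differentiableAt.differentiableWithinAt, differentiableWithinAt_const _⟩
  momentum t ht x _ := by
    have hu : uCh ν t = modeU (Real.exp (-ν * t)) := rfl
    rw [timeDerivWithin_uCh ν ht, gradient_pCh, hu, convect_modeU, laplacian_modeU]
    simp only [add_zero, neg_zero, zero_add, smul_smul]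
    congr 1
    ring
  divFree t _ x _ := divergence_modeU _ x
  noSlip t _ x hx := by
    rcases apply_one_of_mem_frontier_slab hx with h | h <;>
      simp [uCh, modeU, h]
  initial _ _ := rfl

/-! ### The display fails at `(0, x*)` -/

/-- `u(0, x*) = e₀`. [folklore] -/
theorem uCh_zero_xMid (ν : ℝ) : uCh ν 0 xMid = e0 := by
  simp [uCh, modeU]

/-- `∂ₜu(0, x*) = −ν e₀` (within `[0,T)`). [folklore] -/
theorem timeDerivWithin_uCh_zero_xMid (ν : ℝ) {T : ℝ} (hT : 0 < T) :
    timeDerivWithin (Ico 0 T) (uCh ν) 0 xMid = (-ν) • e0 := by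
  rw [timeDerivWithin_uCh ν (show (0 : ℝ) ∈ Ico 0 T from ⟨le_rfl, hT⟩)]
  simp

/-- `∇u(0, x*) = cos(π/2) · shearL = 0`, so `|∇u(0,x*)|² = 0`. [folklore] -/
theorem gradSq_uCh_zero_xMid (ν : ℝ) : gradSq (uCh ν 0) xMid = 0 := by
  have hD : fderiv ℝ (uCh ν 0) xMid = 0 := by
    have hu : uCh ν 0 = modeU (Real.exp (-ν * 0)) := rfl
    rw [hu, fderiv_modeU]
    ext v i
    simp
  rw [gradSq, hD, frobeniusNormSq_zero]

/-- Left side of the display at `(0, x*)`: `∂ₜE + u·∇E = −ν`. [folklore] -/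
theorem lhs_zero_xMid (ν : ℝ) {T : ℝ} (hT : 0 < T) :
    timeDerivWithin (Ico 0 T) (mechE (uCh ν) pCh) 0 xMid + critQ (uCh ν) pCh 0 xMid = -ν := by
  have h0 : (0 : ℝ) ∈ Ico 0 T := ⟨le_rfl, hT⟩
  have hS : UniqueDiffWithinAt ℝ (Ico 0 T) 0 := uniqueDiffOn_Ico 0 T 0 h0
  have hud : DifferentiableAt ℝ (uCh ν 0) xMid := (contDiff_modeU _).differentiable (by simp) xMid
  have hpd : DifferentiableAt ℝ (pCh 0) xMid := differentiableAt_const _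
  have hconv : convect (uCh ν 0) (uCh ν 0) xMid = 0 := convect_modeU _ xMid
  rw [timeDerivWithin_mechE hS (hasDerivAt_uCh ν 0 xMid).differentiableAt.differentiableWithinAt
      (differentiableWithinAt_const _), critQ_eq hud hpd, timeDerivWithin_uCh_zero_xMid ν hT,
    timeDerivWithin_pCh, gradient_pCh, hconv, uCh_zero_xMid]
  simp [real_inner_smul_right]

/-- **The printed display fails for the channel mode**, for every viscosity `ν > 0` and every `T > 0`: the
flow is a strong solution with no-slip on the channel, `x* ∈ Ω`, and at `(0, x*)` the display would read
`−ν = −ν·0`. [cite: Chio2026WeakSingularity, §3.1 p.4] -/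
theorem step0_fails (ν : ℝ) (hν : 0 < ν) (T : ℝ) (hT : 0 < T) :
    IsStrongSolutionOn slab (Ico 0 T) ν (uCh ν 0) (uCh ν) pCh ∧ xMid ∈ slab ∧
      timeDerivWithin (Ico 0 T) (mechE (uCh ν) pCh) 0 xMid + critQ (uCh ν) pCh 0 xMid ≠
        -ν * gradSq (uCh ν 0) xMid := by
  refine ⟨isStrongSolutionOn_uCh ν T, xMid_mem_slab, ?_⟩
  rw [lhs_zero_xMid ν hT, gradSq_uCh_zero_xMid]
  simp [hν.ne']

/-- **C55 kill (solution grain): `Step_0` — the «pointwise mechanical energy transport equation» of §3.1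
p. 4 asserted for every strong solution with no-slip — is false**; witness: the Stokes channel mode with
`ν = 1`, `T = 1`, at `(t,x) = (0, (π/2)e₁)`. [cite: Chio2026WeakSingularity, §3.1 p.4] -/
theorem not_Step_0 : ¬ Literature.Claims.NS.Chio2026.Step_0 := by
  intro h
  have key := h 1 one_pos slab isOpen_slab 1 one_pos (uCh 1 0) (uCh 1) pCh (isStrongSolutionOn_uCh 1 1)
    0 ⟨le_rfl, one_pos⟩ xMid xMid_mem_slab
  exact (step0_fails 1 one_pos 1 one_pos).2.2 key

/-- **C55 kill (derivation grain): `EnergyTransport_pt` is false** — by the skeleton's own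
`step0_of_pt : EnergyTransport_pt → Step_0`. [cite: Chio2026WeakSingularity, §3.1 p.4] -/
theorem not_EnergyTransport_pt : ¬ Literature.Claims.NS.Chio2026.EnergyTransport_pt :=
  fun h => not_Step_0 (step0_of_pt h)

/-! ### No pressure gauge repairs the display for this flow -/

/-- With the gauge pressure `p = c(t)`, the witness is still a strong solution on the channel (the pressure
enters the momentum equation only through `∇p = 0`). [folklore] -/
theorem isStrongSolutionOn_uCh_gauge (ν T : ℝ) (c : ℝ → ℝ) (hc : DifferentiableOn ℝ c (Ico 0 T)) :
    IsStrongSolutionOn slab (Ico 0 T) ν (uCh ν 0) (uCh ν) (pG c) where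
  smooth_u t _ := contDiff_modeU _
  smooth_p _ _ := contDiff_const
  timeDiff t ht x _ := ⟨(hasDerivAt_uCh ν t x).differentiableAt.differentiableWithinAt, hc t ht⟩
  momentum t ht x _ := by
    have hu : uCh ν t = modeU (Real.exp (-ν * t)) := rfl
    have hgrad : gradient (pG c t) x = 0 := gradient_fun_const x (c t)
    rw [timeDerivWithin_uCh ν ht, hgrad, hu, convect_modeU, laplacian_modeU]
    simp only [add_zero, neg_zero, zero_add, smul_smul]
    congr 1
    ring
  divFree t _ x _ := divergence_modeU _ x
  noSlip t _ x hx := by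
    rcases apply_one_of_mem_frontier_slab hx with h | h <;>
      simp [uCh, modeU, h]
  initial _ _ := rfl

/-- `|∇u(0,x)|² = cos²(x₁)`. [folklore] -/
theorem gradSq_uCh_zero (ν : ℝ) (x : E3) : gradSq (uCh ν 0) x = Real.cos (x 1) ^ 2 := by
  have hu : uCh ν 0 = modeU (Real.exp (-ν * 0)) := rfl
  rw [gradSq, hu, fderiv_modeU, frobeniusNormSq_eq_sum (EuclideanSpace.basisFun (Fin 3) ℝ)]
  simp [Fin.sum_univ_three, e0, norm_smul]

/-- Left side of the display at `(0, x)` under the gauge `p = c(t)`: `⟪u,∂ₜu⟫ + c'(0) = −ν sin²(x₁) + c'(0)`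
(`c'(0)` the one-sided derivative within `[0,T)`). [folklore] -/
theorem lhs_gauge (ν : ℝ) {T : ℝ} (hT : 0 < T) (c : ℝ → ℝ)
    (hc : DifferentiableWithinAt ℝ c (Ico 0 T) 0) (x : E3) :
    timeDerivWithin (Ico 0 T) (mechE (uCh ν) (pG c)) 0 x + critQ (uCh ν) (pG c) 0 x =
      -(ν * Real.sin (x 1) ^ 2) + derivWithin c (Ico 0 T) 0 := by
  have h0 : (0 : ℝ) ∈ Ico 0 T := ⟨le_rfl, hT⟩
  have hS : UniqueDiffWithinAt ℝ (Ico 0 T) 0 := uniqueDiffOn_Ico 0 T 0 h0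
  have hud : DifferentiableAt ℝ (uCh ν 0) x := (contDiff_modeU _).differentiable (by simp) x
  have hpd : DifferentiableAt ℝ (pG c 0) x := differentiableAt_const _
  have hpt : DifferentiableWithinAt ℝ (fun s => pG c s x) (Ico 0 T) 0 := hc
  have hconv : convect (uCh ν 0) (uCh ν 0) x = 0 := convect_modeU _ x
  have hgrad : gradient (pG c 0) x = 0 := gradient_fun_const x (c 0)
  have hpd' : timeDerivWithin (Ico 0 T) (pG c) 0 x = derivWithin c (Ico 0 T) 0 := rfl
  rw [timeDerivWithin_mechE hS (hasDerivAt_uCh ν 0 x).differentiableAt.differentiableWithinAt hpt,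
    critQ_eq hud hpd, timeDerivWithin_uCh ν h0, hpd', hgrad, hconv]
  simp [uCh, modeU, real_inner_smul_left, real_inner_smul_right]
  ring

/-- **Gauge robustness.** For every `ν > 0`, `T > 0` and every gauge `c` (differentiable at `0` within
`[0,T)`), the display fails for `(u, c)` at `t = 0` at the mid-channel point `x*` or at the quarter point
`x♯`: at `x*` it forces `c'(0) = ν`, at `x♯` it forces `c'(0) = 0`. (Contrast: plane Couette `u = x₁e₀`
satisfies the display with the gauge `p = −νt`.) [folklore] -/
theorem step0_fails_any_gauge (ν : ℝ) (hν : 0 < ν) (T : ℝ) (hT : 0 < T) (c : ℝ → ℝ)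
    (hc : DifferentiableWithinAt ℝ c (Ico 0 T) 0) :
    ¬ ((timeDerivWithin (Ico 0 T) (mechE (uCh ν) (pG c)) 0 xMid + critQ (uCh ν) (pG c) 0 xMid =
          -ν * gradSq (uCh ν 0) xMid) ∧
       (timeDerivWithin (Ico 0 T) (mechE (uCh ν) (pG c)) 0 xQ + critQ (uCh ν) (pG c) 0 xQ =
          -ν * gradSq (uCh ν 0) xQ)) := by
  rintro ⟨hM, hQ⟩
  rw [lhs_gauge ν hT c hc, gradSq_uCh_zero] at hM hQ
  simp only [xMid_apply_one, xQ_apply_one, Real.sin_pi_div_two, Real.cos_pi_div_two,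
    Real.sin_pi_div_four, Real.cos_pi_div_four] at hM hQ
  nlinarith [hM, hQ]

end

end Summit.NavierStokesRegularity.NavierStokesRegularity.Theorems.Chio2026
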